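import Mathlib
import Summits.FinalStateConjecture.FinalStateConjecture.Theorems.PhotonSphereChannelsUniformPhotonSphereChannelsRCoeffRungZero

/-!
# Crux `UniformPhotonSphereChannelsR` (K1R, stmt-FinalStateConjecture-14074), line
# `crum-peeling-recessive-tower` — helper A0, part 2: inversion majorant and packaging

Continuation of `…RCoeffRungZero`: the reciprocal series `g = 1/ω` inherits the profile
(`inversion_abs_le_profile`: `|Ωₙ| ≤ C Rⁿ/(n+1)²`, `4C < 1` ⇒ `|Gₙ| ≤ (C/(1−4C)) Rⁿ/(n+1)²`, by the
same convolution estimate), and `coeffMajorant_rungZero` packages the rung-0 row bounds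
`|Ω 0 n|, |G 0 n| ≤ 40ⁿ` for the VERBATIM hypotheses of the registered `stub_coeffMajorant`
(arrays `Ω G : ℕ → ℕ → ℝ`, inversion relation, rung-0 recursion) — the `ℓ`-free input "A0" of the
line's Theorem A (lead c1/c2 plan).
-/

-- `Summit.<S>.<S>` repeats a namespace component by design (D-0017); off here as in the lakefile.
set_option linter.dupNamespace false

noncomputable section

namespace Summit.FinalStateConjecture.FinalStateConjecture.Theorems.CrumPeelingRecessiveTower

open Finset

/-! ### Inversion: the reciprocal series inherits the profile -/

/-- **Inversion majorant.**  If `Ω₀ = G₀ = 1`, `Σ_{i≤n} Gᵢ Ω_{n−i} = [n = 0]` and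
`|Ω_{m+1}| ≤ C R^{m+1}/(m+2)²` for all `m` with `0 ≤ C`, `4C < 1`, `R > 0`, then
`|G_{m+1}| ≤ (C/(1 − 4C)) R^{m+1}/(m+2)²` for all `m`. -/
theorem inversion_abs_le_profile {Ω G : ℕ → ℝ} {C R : ℝ} (hC0 : 0 ≤ C) (hC : 4 * C < 1)
    (hR : 0 < R) (hΩ0 : Ω 0 = 1) (hG0 : G 0 = 1)
    (hinv : ∀ n, ∑ i ∈ range (n + 1), G i * Ω (n - i) = if n = 0 then 1 else 0)
    (hΩ : ∀ m, |Ω (m + 1)| ≤ C * R ^ (m + 1) / ((m : ℝ) + 2) ^ 2) :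
    ∀ m, |G (m + 1)| ≤ C / (1 - 4 * C) * R ^ (m + 1) / ((m : ℝ) + 2) ^ 2 := by
  set D := C / (1 - 4 * C) with hD
  have h14 : 0 < 1 - 4 * C := by linarith
  have hD0 : 0 ≤ D := div_nonneg hC0 h14.le
  have hDC : C + 4 * C * D = D := by
    have h14ne : 1 - 4 * C ≠ 0 := h14.ne'
    have h14ne' : 1 - C * 4 ≠ 0 := fun h => h14ne (by linarith)
    rw [hD]
    field_simp
    ring
  intro m
  induction m using Nat.strong_induction_on with
  | _ m ih =>
    -- the inversion identity at order m + 1: G_{m+1} + Σ_{i<m} G_{i+1} Ω_{m−i} + Ω_{m+1} = 0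
    have h := hinv (m + 1)
    rw [sum_range_succ, sum_range_succ'] at h
    simp only [Nat.sub_self, Nat.sub_zero, hΩ0, hG0, mul_one, one_mul,
      Nat.add_eq_zero_iff, one_ne_zero, and_false, ↓reduceIte] at h
    have e : ∀ i ∈ range m, G (i + 1) * Ω (m + 1 - (i + 1)) = G (i + 1) * Ω (m - i) := by
      intro i hi; rw [show m + 1 - (i + 1) = m - i by omega]
    rw [sum_congr rfl e] at h
    have hGeq : G (m + 1) = -(Ω (m + 1)) - ∑ i ∈ range m, G (i + 1) * Ω (m - i) := by linarith
    -- bound the convolution by the profiles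
    have hconv : |∑ i ∈ range m, G (i + 1) * Ω (m - i)| ≤
        C * D * R ^ (m + 1) * (4 / ((m : ℝ) + 3) ^ 2) := by
      refine (abs_sum_le_sum_abs _ _).trans ?_
      have hterm : ∀ i ∈ range m, |G (i + 1) * Ω (m - i)| ≤
          C * D * R ^ (m + 1) * (1 / (((i : ℝ) + 2) ^ 2 * ((((m + 1 : ℕ)) : ℝ) - i) ^ 2)) := by
        intro i hi
        rw [mem_range] at hi
        rw [abs_mul]
        have hi1 : |G (i + 1)| ≤ D * R ^ (i + 1) / ((i : ℝ) + 2) ^ 2 := ih i hi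
        have hi2 : |Ω (m - i)| ≤ C * R ^ (m - i) / ((((m - i - 1 : ℕ)) : ℝ) + 2) ^ 2 := by
          have := hΩ (m - i - 1)
          rwa [show m - i - 1 + 1 = m - i by omega] at this
        have hpos2 : 0 ≤ C * R ^ (m - i) / ((((m - i - 1 : ℕ)) : ℝ) + 2) ^ 2 := by positivity
        refine (mul_le_mul hi1 hi2 (abs_nonneg _) (by positivity)).trans (le_of_eq ?_)
        have hcast : (((m - i - 1 : ℕ)) : ℝ) + 2 = (((m + 1 : ℕ)) : ℝ) - i := by
          have h' : i + 1 ≤ m := by omega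
          rw [Nat.cast_sub (by omega), Nat.cast_sub (by omega)]
          push_cast; ring
        rw [hcast]
        have hpow : R ^ (i + 1) * R ^ (m - i) = R ^ (m + 1) := by
          rw [← pow_add]; congr 1; omega
        have hne1 : ((i : ℝ) + 2) ^ 2 ≠ 0 := by positivity
        have hne2 : ((((m + 1 : ℕ)) : ℝ) - i) ^ 2 ≠ 0 := by
          have : (0 : ℝ) < (((m + 1 : ℕ)) : ℝ) - i := by
            have h' : i + 1 ≤ m := by omega
            push_cast
            have : (i : ℝ) + 1 ≤ m := by exact_mod_cast h'
            linarith
          positivity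
        field_simp
        rw [← hpow]
        ring
      refine (sum_le_sum hterm).trans ?_
      rw [← mul_sum]
      apply mul_le_mul_of_nonneg_left _ (by positivity)
      have hc := conv_inv_sq_le (m + 1)
      rw [show m + 1 - 1 = m by omega] at hc
      push_cast at hc ⊢
      rw [show (m : ℝ) + 1 + 2 = (m : ℝ) + 3 by ring] at hc
      exact hc
    -- assemble
    rw [hGeq]
    refine (abs_sub _ _).trans ?_
    rw [abs_neg]
    have hm := hΩ m
    refine (add_le_add hm hconv).trans ?_
    -- C R^{m+1}/(m+2)² + 4 C D R^{m+1}/(m+3)² ≤ D R^{m+1}/(m+2)²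
    have hq : (0 : ℝ) < R ^ (m + 1) := by positivity
    have h23 : 4 / ((m : ℝ) + 3) ^ 2 ≤ 4 / ((m : ℝ) + 2) ^ 2 := by
      apply div_le_div_of_nonneg_left (by norm_num) (by positivity)
      nlinarith [Nat.cast_nonneg (α := ℝ) m]
    have hstep : C * D * R ^ (m + 1) * (4 / ((m : ℝ) + 3) ^ 2) ≤
        C * D * R ^ (m + 1) * (4 / ((m : ℝ) + 2) ^ 2) :=
      mul_le_mul_of_nonneg_left h23 (by positivity)
    calc C * R ^ (m + 1) / ((m : ℝ) + 2) ^ 2 + C * D * R ^ (m + 1) * (4 / ((m : ℝ) + 3) ^ 2)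
        ≤ C * R ^ (m + 1) / ((m : ℝ) + 2) ^ 2 + C * D * R ^ (m + 1) * (4 / ((m : ℝ) + 2) ^ 2) :=
          add_le_add le_rfl hstep
      _ = (C + 4 * C * D) * (R ^ (m + 1) / ((m : ℝ) + 2) ^ 2) := by ring
      _ = D * R ^ (m + 1) / ((m : ℝ) + 2) ^ 2 := by rw [hDC]; ring

/-! ### Packaging for the registered arrays of `stub_coeffExists` / `stub_coeffMajorant` -/

/-- **A0 for the registered arrays.**  For `s ≤ 2`, `ℓ ≥ 1` and arrays `Ω G : ℕ → ℕ → ℝ` with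
`Ω k 0 = G k 0 = 1`, the inversion relation and the registered rung-0 recursion for `Ω 0`, the rung-0
row satisfies `|Ω 0 n| ≤ 40ⁿ` and `|G 0 n| ≤ 40ⁿ` for every `n` (indeed `≤ (1/5)·40ⁿ/(n+1)²` resp.
`≤ 40ⁿ/(n+1)²` for `n ≥ 1`).  Hypotheses are VERBATIM those of `stub_coeffMajorant` restricted to
the rung-0 row. -/
theorem coeffMajorant_rungZero (s ℓ : ℕ) (hs : s ≤ 2) (hℓ : 1 ≤ ℓ) (Ω G : ℕ → ℕ → ℝ)
    (hΩ0 : ∀ k, Ω k 0 = 1) (hG0 : ∀ k, G k 0 = 1)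
    (hinv : ∀ k n, ∑ i ∈ Finset.range (n + 1), G k i * Ω k (n - i) = if n = 0 then 1 else 0)
    (hrec0 : ∀ n, (ℓ : ℝ) ^ 2 * ∑ i ∈ Finset.range (n + 1), Ω 0 i * Ω 0 (n - i)
        + (ℓ : ℝ) * (((n : ℝ) + 1) * Ω 0 n - 2 * (n : ℝ) * Ω 0 (n - 1))
        = (if n = 0 then (ℓ : ℝ) * ((ℓ : ℝ) + 1)
           else if n = 1 then 2 * (1 - (s : ℝ) ^ 2) - 2 * ((ℓ : ℝ) * ((ℓ : ℝ) + 1))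
           else if n = 2 then -(4 * (1 - (s : ℝ) ^ 2)) else 0)) :
    ∀ n, |Ω 0 n| ≤ 40 ^ n ∧ |G 0 n| ≤ 40 ^ n := by
  have hrec : ∀ n, (ℓ : ℝ) ^ 2 * ∑ i ∈ range (n + 1), Ω 0 i * Ω 0 (n - i)
      + (ℓ : ℝ) * (((n : ℝ) + 1) * Ω 0 n - 2 * (n : ℝ) * Ω 0 (n - 1)) = rung0Rhs s ℓ n :=
    fun n => hrec0 n
  have hΩprof := rung0_abs_le_profile hs hℓ (hΩ0 0) hrec
  -- the profile in the `m + 2` form needed by the inversion lemma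
  have hΩ' : ∀ m, |Ω 0 (m + 1)| ≤ (1 / 5) * 40 ^ (m + 1) / ((m : ℝ) + 2) ^ 2 := by
    intro m
    have h := hΩprof m
    unfold rung0Profile at h
    have e : ((((m + 1 : ℕ)) : ℝ) + 1) = (m : ℝ) + 2 := by push_cast; ring
    rwa [e] at h
  have hGprof := inversion_abs_le_profile (C := 1 / 5) (R := 40) (by norm_num) (by norm_num)
    (by norm_num) (hΩ0 0) (hG0 0) (hinv 0) hΩ'
  intro n
  refine ⟨rung0_abs_le_pow hs hℓ (hΩ0 0) hrec n, ?_⟩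
  rcases n with _ | m
  · rw [hG0 0]; simp
  · refine (hGprof m).trans ?_
    norm_num
    rw [div_le_iff₀ (by positivity)]
    have h1 : (1 : ℝ) ≤ ((m : ℝ) + 2) ^ 2 := by
      have h0 : (0 : ℝ) ≤ (m : ℝ) := Nat.cast_nonneg m
      nlinarith
    have hq : (0 : ℝ) < 40 ^ (m + 1) := by positivity
    nlinarith

end Summit.FinalStateConjecture.FinalStateConjecture.Theorems.CrumPeelingRecessiveTower
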